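import Mathlib
import Summits.NavierStokesRegularity.NavierStokesRegularity.Theorems.BarrierStepRungThreeWindowTwoFunction
import HarnessLib

/-!
# Two-function form, POINTWISE lemmas (route `BarrierStepRungThree`, repaired format K2″)

Supports item stmt-NavierStokesRegularity-24513 `BarrierCertificateR`. The file
`BarrierStepRungThreeWindowTwoFunction.lean` packages the two-function (tube `h` + clock `w`) certificate
into ONE theorem ending in the rung. Certificate writers who feed a DIFFERENT top-level template (e.g.
ns-bsr3-p4's `taoLadderRungThree_target_of_boxCertificateKit`, which takes the single function `v` and
its five box statements) need the same case analysis as free-standing lemmas. Here they are, for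

  `v x := w x + C · max (h x) 0 ^ 2`:

* `WindowBox.tubeClock_cases` — `v x ≤ 0` ⇒ (`h x ≤ 0 ∧ w x ≤ 0`) ∨ (`0 ≤ h x ∧ w x + C·(h x)² ≤ 0`);
* `WindowBox.tubeClock_nonpos_of` — `h y ≤ 0 → w y ≤ 0 → v y ≤ 0` (datum / re-entry);
* `WindowBox.tubeClock_fderiv_apply` — `(fderiv v x) d = (fderiv w x) d + C·(2·max (h x) 0)·(fderiv h x) d`;
* `WindowBox.tubeClock_le_of_cases` — a pointwise bound `v x ≤ 0 → (fderiv v x) d ≤ m` from the tube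
  case (`fderiv w ≤ m`) and the collar case (`fderiv w ≤ m`, inflow `fderiv h ≤ 0`), `C ≥ 0`;
* `WindowBox.tubeClock_opNorm_le_of_cases` — `v x ≤ 0 → ‖fderiv v x‖ ≤ Λ` from `‖fderiv w x‖ ≤ Λ`
  (tube) and `‖fderiv w x‖ + 2C·h x·‖fderiv h x‖ ≤ Λ` (collar);
* `WindowBox.tubeClock_proper_of_cases`, `WindowBox.tubeClock_floor_of_cases` — properness and clock
  floor from their tube/collar versions.

HONEST FRAMING: elementary real analysis / bookkeeping for MODEL-lane certificates (class rung TL-M3);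
no certificate is produced; nothing here is a statement about the Navier–Stokes equations.
-/

noncomputable section

-- the sub-problem namespace `Summit.NavierStokesRegularity.NavierStokesRegularity` repeats the summit name by design (D-0017)
set_option linter.dupNamespace false

namespace Summit.NavierStokesRegularity.NavierStokesRegularity.Theorems

namespace WindowBox

variable {n : ℕ} {w h : (Fin 4 → Fin n → ℝ) → ℝ} {C : ℝ}

/-- Case split of the region `{v ≤ 0}` for `v = w + C·max(h,0)²`: tube (`h ≤ 0`, `w ≤ 0`) or collar
(`0 ≤ h`, `w + C h² ≤ 0`). [folklore] -/
theorem tubeClock_cases {x : Fin 4 → Fin n → ℝ} (hvx : w x + C * max (h x) 0 ^ 2 ≤ 0) :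
    (h x ≤ 0 ∧ w x ≤ 0) ∨ (0 ≤ h x ∧ w x + C * h x ^ 2 ≤ 0) := by
  rcases le_or_gt (h x) 0 with hx | hx
  · left
    refine ⟨hx, ?_⟩
    rwa [tubeClock_apply_of_nonpos hx] at hvx
  · right
    refine ⟨hx.le, ?_⟩
    rwa [tubeClock_apply_of_nonneg hx.le] at hvx

/-- Inside the tube with a nonpositive clock the combined function is nonpositive (datum / re-entry
clauses). [folklore] -/
theorem tubeClock_nonpos_of {y : Fin 4 → Fin n → ℝ} (hy : h y ≤ 0) (hwy : w y ≤ 0) :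
    w y + C * max (h y) 0 ^ 2 ≤ 0 := by
  rw [tubeClock_apply_of_nonpos hy]; exact hwy

/-- The Fréchet derivative of `v = w + C·max(h,0)²` applied to a direction. [folklore] -/
theorem tubeClock_fderiv_apply (hw : ContDiff ℝ 1 w) (hh : ContDiff ℝ 1 h) (C : ℝ)
    (x d : Fin 4 → Fin n → ℝ) :
    (fderiv ℝ (fun x => w x + C * max (h x) 0 ^ 2) x) d =
      (fderiv ℝ w x) d + C * (2 * max (h x) 0) * (fderiv ℝ h x) d := by
  rw [(hasFDerivAt_tubeClock hw hh C x).fderiv]; rfl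

/-- **Pointwise decrease transfer.** If in the tube case `(fderiv w x) d ≤ m`, and in the collar case
`(fderiv w x) d ≤ m` together with the inflow `(fderiv h x) d ≤ 0`, then on the region
`(fderiv v x) d ≤ m` (`C ≥ 0`). [folklore] -/
theorem tubeClock_le_of_cases (hw : ContDiff ℝ 1 w) (hh : ContDiff ℝ 1 h) (hC : 0 ≤ C)
    {x d : Fin 4 → Fin n → ℝ} {m : ℝ}
    (hin : h x ≤ 0 → w x ≤ 0 → (fderiv ℝ w x) d ≤ m)
    (hcol : 0 ≤ h x → w x + C * h x ^ 2 ≤ 0 → (fderiv ℝ w x) d ≤ m ∧ (fderiv ℝ h x) d ≤ 0)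
    (hvx : w x + C * max (h x) 0 ^ 2 ≤ 0) :
    (fderiv ℝ (fun x => w x + C * max (h x) 0 ^ 2) x) d ≤ m := by
  rw [tubeClock_fderiv_apply hw hh C x d]
  rcases tubeClock_cases hvx with ⟨h1, h2⟩ | ⟨h1, h2⟩
  · rw [max_eq_right h1, mul_zero, mul_zero, zero_mul, add_zero]
    exact hin h1 h2
  · rw [max_eq_left h1]
    obtain ⟨hd, hi⟩ := hcol h1 h2
    have hprod : C * (2 * h x) * (fderiv ℝ h x) d ≤ 0 :=
      mul_nonpos_of_nonneg_of_nonpos (by positivity) hi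
    linarith

/-- **Pointwise operator-norm transfer.** `‖fderiv v x‖ ≤ Λ` on the region from `‖fderiv w x‖ ≤ Λ`
in the tube and `‖fderiv w x‖ + 2C·h x·‖fderiv h x‖ ≤ Λ` in the collar (`C ≥ 0`). [folklore] -/
theorem tubeClock_opNorm_le_of_cases (hw : ContDiff ℝ 1 w) (hh : ContDiff ℝ 1 h) (hC : 0 ≤ C)
    {x : Fin 4 → Fin n → ℝ} {Λ : ℝ}
    (hin : h x ≤ 0 → w x ≤ 0 → ‖fderiv ℝ w x‖ ≤ Λ)
    (hcol : 0 ≤ h x → w x + C * h x ^ 2 ≤ 0 → ‖fderiv ℝ w x‖ + 2 * C * h x * ‖fderiv ℝ h x‖ ≤ Λ)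
    (hvx : w x + C * max (h x) 0 ^ 2 ≤ 0) :
    ‖fderiv ℝ (fun x => w x + C * max (h x) 0 ^ 2) x‖ ≤ Λ := by
  rw [(hasFDerivAt_tubeClock hw hh C x).fderiv]
  rcases tubeClock_cases hvx with ⟨h1, h2⟩ | ⟨h1, h2⟩
  · rw [max_eq_right h1, mul_zero, mul_zero, zero_smul, add_zero]
    exact hin h1 h2
  · rw [max_eq_left h1]
    calc ‖fderiv ℝ w x + (C * (2 * h x)) • fderiv ℝ h x‖
        ≤ ‖fderiv ℝ w x‖ + ‖(C * (2 * h x)) • fderiv ℝ h x‖ := norm_add_le _ _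
      _ = ‖fderiv ℝ w x‖ + 2 * C * h x * ‖fderiv ℝ h x‖ := by
          rw [norm_smul, Real.norm_eq_abs, abs_of_nonneg (by positivity)]; ring
      _ ≤ Λ := hcol h1 h2

/-- **Properness transfer** (clause 24) from the tube and collar versions. [folklore] -/
theorem tubeClock_proper_of_cases {Mw : Fin 4 → Fin n → ℝ}
    (hin : ∀ x : Fin 4 → Fin n → ℝ, w x ≤ 0 → h x ≤ 0 → ∀ i j, |x i j| ≤ Mw i j)
    (hcol : ∀ x : Fin 4 → Fin n → ℝ, 0 ≤ h x → w x + C * h x ^ 2 ≤ 0 → ∀ i j, |x i j| ≤ Mw i j) :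
    ∀ x : Fin 4 → Fin n → ℝ, w x + C * max (h x) 0 ^ 2 ≤ 0 → ∀ i j, |x i j| ≤ Mw i j := by
  intro x hvx i j
  rcases tubeClock_cases hvx with ⟨h1, h2⟩ | ⟨h1, h2⟩
  · exact hin x h2 h1 i j
  · exact hcol x h1 h2 i j

/-- **Clock-floor transfer** (clause 25) from the tube and collar versions. [folklore] -/
theorem tubeClock_floor_of_cases {g : (Fin 4 → Fin n → ℝ) → ℝ} {γ c : ℝ}
    (hin : ∀ x : Fin 4 → Fin n → ℝ, w x ≤ 0 → h x ≤ 0 → 0 < g x → -(γ * c) < w x)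
    (hcol : ∀ x : Fin 4 → Fin n → ℝ, 0 ≤ h x → w x + C * h x ^ 2 ≤ 0 → 0 < g x →
      -(γ * c) < w x + C * h x ^ 2) :
    ∀ x : Fin 4 → Fin n → ℝ, w x + C * max (h x) 0 ^ 2 ≤ 0 → 0 < g x →
      -(γ * c) < w x + C * max (h x) 0 ^ 2 := by
  intro x hvx hgx
  rcases tubeClock_cases hvx with ⟨h1, h2⟩ | ⟨h1, h2⟩
  · rw [tubeClock_apply_of_nonpos h1]; exact hin x h2 h1 hgx
  · rw [tubeClock_apply_of_nonneg h1]; exact hcol x h1 h2 hgx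

end WindowBox

end Summit.NavierStokesRegularity.NavierStokesRegularity.Theorems

end
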